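import Literature.Computability.AlgebraicComplexity.SymmetricArithCircuit
import Literature.Computability.AlgebraicComplexity.StandardFamilies
import Mathlib.Analysis.SpecialFunctions.Pow.Real
import Mathlib.Order.Filter.AtTopBot.Basic
import Mathlib.Data.Set.Card
import HarnessLib

/-!
# Dawar–Wilsenach: the exponential lower bound for square-symmetric circuits computing the permanent

Topic `Computability/AlgebraicComplexity`, namespace `Literature.Computability.AlgebraicComplexity`.

A. Dawar, G. Wilsenach, *Symmetric Arithmetic Circuits*, Theory of Computing 21 (14) (2025)
1–32 (journal version of ICALP 2020; held text `paper:url-c71cdde2477c`), over the tree's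
rendering of their circuits (`SymmetricArithCircuit.lean`: `LabelledArithCircuit` = Def. 2.2,
`IsAutomorphismExtending` = Def. 3.6, `IsSymmetric` = Def. 3.7) and the tree's permanent
`perPoly` (`StandardFamilies.lean`).

* `LabelledArithCircuit.autOrbit`, `LabelledArithCircuit.orbitSize` — §3.3 (p. 10): "Let `C` be
  a `Γ`-symmetric circuit … the *orbit* of a gate `g` is the set of `h` such that there exists an
  automorphism `π` of `C` extending some permutation in `Γ` with `π(g) = h`. We write `ORB(C)`
  for the maximum size of an orbit in `C`, and call it the *orbit size* of `C`."  Real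
  definitions (no stubs); `orbitSize_le_size` (an orbit is a set of gates) is proved.
* `DawarWilsenach2025_thm71` — **Theorem 7.1** (p. 18), AS PRINTED: "There is no family of
  square-symmetric arithmetic circuits over any field `F` of characteristic `0` of orbit size
  `2^{o(n)}` computing `{PERM_n}`."  Square-symmetric (§3.2–3.3, pp. 8–10) = symmetric under the
  simultaneous (diagonal) action of `Sym_n` on the rows and columns of the `n × n` variable
  matrix, i.e. `IsSymmetric (Equiv.Perm (Fin n))` for Mathlib's componentwise action on
  `Fin n × Fin n` (single output gate, fixed: `Y = Unit` with the trivial action). "Orbit size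
  not `2^{o(n)}`" is rendered as: some `ε > 0` has `ORB(C_n) ≥ 2^{ε n}` for infinitely many `n`
  (`∃ᶠ n in atTop`). Named fact (the printed proof goes through symmetric threshold circuits,
  supports and counting width of the number of perfect matchings of Cai–Fürer–Immerman-type
  graphs, Thms 5.1, 6.3–6.4, 7.2 — none of it in the tree).
* `DawarWilsenach2025_thm71.size_form` — the SIZE COROLLARY used by route
  `Summits/ValiantsHypothesis/ValiantsHypothesis/Theses/ProofCarryingSymmetry.lean`
  (its crux `SquareSymmetricPermLB` is this corollary at `F = ℂ`, in the `∀ n₀, ∃ n ≥ n₀` form):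
  since an orbit is a set of gates, `ORB(C) ≤ |C|`, so no such family has SIZE `2^{o(n)}` either.
  Proved here from the named fact.

What is NOT here: Theorem 4.1 (polynomial-size transpose-symmetric circuits for `{DET_n}` in
characteristic `0`, Le Verrier — a construction a prover can carry out directly; it calibrates the
route's support `DetCalibration`), Theorem 7.11 (matrix-symmetric circuits, odd characteristic),
threshold circuits, supports (Def. 6.1 is in `SymmetricArithCircuit.lean`) and counting width.
-/

noncomputable section

namespace Literature.Computability.AlgebraicComplexity

open Filter

universe u v w z

namespace LabelledArithCircuit

variable {K : Type u} {X : Type v} {Y : Type z} {G : Type w}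

/-- The **orbit of a gate** `g` of a labelled circuit under a group `Γ` acting on its variables
(and outputs): the gates `h = π g` for some automorphism `π` of `C` extending some `γ ∈ Γ`
(Dawar–Wilsenach §3.3: "the orbit of `g` is the set of `h ∈ C` such that there exists an
automorphism `π` of `C` extending some permutation in `Γ` with `π(g) = h`").
[cite: DawarWilsenach2025, §3.3 (p. 10)] -/
def autOrbit (C : LabelledArithCircuit K X Y G) (Γ : Type*) [Group Γ] [MulAction Γ X]
    [MulAction Γ Y] (g : G) : Set G :=
  {h | ∃ (γ : Γ) (π : Equiv.Perm G), C.IsAutomorphismExtending γ π ∧ π g = h}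

/-- The **orbit size** `ORB(C)` of a (finite) labelled circuit: the maximum size of the orbit of
a gate ("We write `ORB(C)` for the maximum size of an orbit in `C`, and call it the orbit size
of `C`"). [cite: DawarWilsenach2025, §3.3 (p. 10)] -/
def orbitSize [Fintype G] (C : LabelledArithCircuit K X Y G) (Γ : Type*) [Group Γ]
    [MulAction Γ X] [MulAction Γ Y] : ℕ :=
  Finset.univ.sup fun g => (C.autOrbit Γ g).ncard

/-- An orbit is a set of gates, so the orbit size is at most the size (number of gates).
[cite: DawarWilsenach2025, §3.3 (p. 10)] -/
theorem orbitSize_le_size [Fintype G] (C : LabelledArithCircuit K X Y G) (Γ : Type*) [Group Γ]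
    [MulAction Γ X] [MulAction Γ Y] : C.orbitSize Γ ≤ C.size := by
  unfold orbitSize size
  refine Finset.sup_le fun g _ => ?_
  calc (C.autOrbit Γ g).ncard ≤ (Set.univ : Set G).ncard := Set.ncard_le_ncard (Set.subset_univ _)
    _ = Fintype.card G := by rw [Set.ncard_univ, Nat.card_eq_fintype_card]

end LabelledArithCircuit

/-- **Dawar–Wilsenach 2025, Theorem 7.1** (AS PRINTED, p. 18): "There is no family of
square-symmetric arithmetic circuits over any field `F` of characteristic `0` of orbit size
`2^{o(n)}` computing `{PERM_n}`." Rendering: for every field `F` of characteristic zero and every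
family `(C_n)` of labelled arithmetic circuits over `F` on the variable matrix `Fin n × Fin n`
with one output, each `C_n` symmetric (Def. 3.7) under the diagonal action of `Sym_n`
("square-symmetric") and computing `per_n` (`perPoly`), the orbit sizes are not `2^{o(n)}`:
some `ε > 0` has `2^{ε n} ≤ ORB(C_n)` for infinitely many `n`. Named fact (proof: symmetric
threshold circuits Thm 5.1, supports and counting width Thms 6.3–6.4, CFI-type graphs Thm 7.2).
It grounds `Summit.ValiantsHypothesis.ValiantsHypothesis.Theses.ProofCarryingSymmetry.SquareSymmetricPermLB`
(the size corollary at `F = ℂ`, see `DawarWilsenach2025_thm71.size_form`).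
[cite: DawarWilsenach2025, Thm. 7.1 (p. 18)] -/
def DawarWilsenach2025_thm71 : Prop :=
  ∀ (F : Type) [Field F] [CharZero F] (G : ℕ → Type) [∀ n, Fintype (G n)]
    (C : ∀ n, LabelledArithCircuit F (Fin n × Fin n) Unit (G n)),
    (∀ n, (C n).IsSymmetric (Equiv.Perm (Fin n))) →
    (∀ n, (C n).eval ((C n).output ()) = perPoly (Fin n) F) →
    ∃ ε : ℝ, 0 < ε ∧ ∃ᶠ n : ℕ in atTop,
      (2 : ℝ) ^ (ε * n) ≤ ((C n).orbitSize (Equiv.Perm (Fin n)) : ℝ)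

/-- **Size form of Theorem 7.1** (the corollary "no square-symmetric family of SIZE `2^{o(n)}`
computes the permanent", since `ORB(C) ≤ |C|`), in the `∀ n₀, ∃ n ≥ n₀` form used by route
ProofCarryingSymmetry: from the named fact. [cite: DawarWilsenach2025, Thm. 7.1 (p. 18)] -/
theorem DawarWilsenach2025_thm71.size_form (h : DawarWilsenach2025_thm71)
    (F : Type) [Field F] [CharZero F] (G : ℕ → Type) [∀ n, Fintype (G n)]
    (C : ∀ n, LabelledArithCircuit F (Fin n × Fin n) Unit (G n))
    (hsym : ∀ n, (C n).IsSymmetric (Equiv.Perm (Fin n)))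
    (hper : ∀ n, (C n).eval ((C n).output ()) = perPoly (Fin n) F) :
    ∃ ε : ℝ, 0 < ε ∧ ∀ n₀ : ℕ, ∃ n ≥ n₀, (2 : ℝ) ^ (ε * n) ≤ Fintype.card (G n) := by
  obtain ⟨ε, hε, hfreq⟩ := h F G C hsym hper
  refine ⟨ε, hε, fun n₀ => ?_⟩
  obtain ⟨n, hn, hle⟩ := (hfreq.and_eventually (eventually_ge_atTop n₀)).exists
  refine ⟨n, hle, hn.trans ?_⟩
  have := (C n).orbitSize_le_size (Equiv.Perm (Fin n))
  exact_mod_cast this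

end Literature.Computability.AlgebraicComplexity
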